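import Summits.CriticalPhenomena.Ising3DConformalLimit.Theorems.EnergyNotSigmaSquaredGapForcesFarMergingFloorsNecessity
import Summits.CriticalPhenomena.Ising3DConformalLimit.Theorems.EnergyNotSigmaSquaredGapForcesFarMergingSandwichOctaveCountingAux
import Mathlib.Analysis.SpecialFunctions.Log.Base

/-! # Opacity at every octave forces a power law of the full one-pinch ladder
(line `screening-form-lemma-a1` of crux `GapForcesFarMerging`, item stmt-CriticalPhenomena-4468;
registered helper `pinchDecay_of_opacityAllOctaves`, the GAP-strength certificate of the all-octave
envelope of stub S6a `HazardRelocation`)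

Write `A(r;m) = pinchScreen n r m` for the one-pinch screening ladder (duplicated strand `0 → up m`
explored inside `Λ_r`, probed by `(e₂, dn m)`, box size `n` large). Once the probe points lie in `Λ_n`
(`n ≥ 2m+1`) the ladder takes values in `[0,1]` (`opDecay_pinchScreen_nonneg`, `opDecay_pinchScreen_le_one`:
Griffiths I and volume monotonicity, `screenWeight_mem_Icc`) and is ANTITONE in the radius
(`floorsNec_pinchScreen_anti`). If every large octave is opaque — `A(2^{j+1};m) ≤ (1-c)·A(2^j;m)` for
`j ≥ j₀`, `m ≥ 2^{j+3}`, large `n` — then along the octaves `j₀ ≤ j < K`, `2^{K+3} ≤ m < 2^{K+4}`, the ladder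
is squeezed geometrically, `A(2^K;m) ≤ λ^{K-j₀}` with `λ = max(1-c, 1/2) = 2^{-κ}`, `κ = -log₂ λ > 0`, and
antitonicity gives `A(n;m) ≤ A(2^K;m) ≤ λ^{-(j₀+4)}·(2^{K+4})^{-κ} ≤ λ^{-(j₀+4)}·m^{-κ}` for EVERY large `m`:
a one-pinch power law at every scale (stronger than the line's `OnePinchScreeningDecay`, which asks it
along infinitely many `m`). Elementary real analysis and filters; no literature input beyond the landed
antitonicity (the rpow bookkeeping `(2^K)^{-κ} = (2^{-κ})^K` is the landed
`EnergyNotSigmaSquaredGapForcesFarMergingSandwich.OctaveCountingProof.two_pow_rpow_neg`). -/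

noncomputable section

namespace Summit.CriticalPhenomena.Ising3DConformalLimit.EnergyNotSigmaSquaredGapForcesFarMerging

open scoped symmDiff ENNReal
open MeasureTheory Filter Finset
open Literature.Probability.LatticeModels Literature.Probability.Percolation
open Summit.CriticalPhenomena.Ising3DConformalLimit.Theorems.GapForcesFarMerging.Negative (e₁ e₂ cc2 xR up dn)
open Summit.CriticalPhenomena.Ising3DConformalLimit.GapForcesFarMergingScreening

/-! ### The ladder takes values in `[0,1]` -/

/-- `0 ≤ A(r;m)` once the probe points `e₂, dn m` lie in `Λ_n` (the integrand `screenWeight` is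
nonnegative, Griffiths I). [folklore] -/
theorem opDecay_pinchScreen_nonneg {n m : ℕ} (r : ℕ) (he : (e₂ : Site 3) ∈ box 3 n)
    (hd : dn m ∈ box 3 n) : 0 ≤ pinchScreen n r m :=
  integral_nonneg fun ω => floorsRed_screenWeight_nonneg (r := r) (o := 0) he hd ω

/-- `A(r;m) ≤ 1` once `up m, e₂, dn m ∈ Λ_n` (the integrand is `≤ 1` and the box law is a probability
measure). [folklore] -/
theorem opDecay_pinchScreen_le_one {n m : ℕ} (r : ℕ) (hup : up m ∈ box 3 n) (he : (e₂ : Site 3) ∈ box 3 n)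
    (hd : dn m ∈ box 3 n) : pinchScreen n r m ≤ 1 := by
  haveI := floorsRed_isProbabilityMeasure (n := n) hup
  have h : pinchScreen n r m ≤
      ∫ _ω, (1 : ℝ) ∂(sourcedDoubleCurrentLaw 3 n (criticalBeta 3) ({0} ∆ {up m}) ∅) :=
    integral_mono (floorsRed_integrable _ (floorsRed_abs_screenWeight_le n r 0 e₂ (dn m)))
      (integrable_const 1) fun ω => (screenWeight_mem_Icc he hd ω).2
  simpa using h

/-! ### The registered helper -/

/-- **OPACITY AT EVERY OCTAVE FORCES A POWER LAW OF THE FULL LADDER** (registered helper of line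
`screening-form-lemma-a1`, the GAP-strength certificate of the all-octave envelope of S6a `HazardRelocation`):
if for some `c > 0` and all octaves `j ≥ j₀`, all far scales `m ≥ 2^{j+3}` and all large box sizes `n` the
one-pinch screening ladder drops by the factor `1 - c` across the octave, `A(2^{j+1};m) ≤ (1-c)·A(2^j;m)`,
then the FULL one-pinch mean screening decays polynomially at every large scale:
`A(n;m) ≤ C·m^{-κ}` eventually in `m` and then in `n`, with `2^{-κ} = max(1-c, 1/2)` and `C = 2^{(j₀+4)κ}`
(geometric squeeze along `j₀ ≤ j < K`, `2^{K+3} ≤ m < 2^{K+4}`, then antitonicity `A(n;m) ≤ A(2^K;m)`). [folklore] -/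
theorem pinchDecay_of_opacityAllOctaves : (∃ c : ℝ, 0 < c ∧ ∃ j₀ : ℕ, ∀ j : ℕ, j₀ ≤ j → ∀ m : ℕ, 2 ^ (j + 3) ≤ m → ∀ᶠ n : ℕ in atTop, pinchScreen n (2 ^ (j + 1)) m ≤ (1 - c) * pinchScreen n (2 ^ j) m) → ∃ κ C : ℝ, 0 < κ ∧ ∀ᶠ m : ℕ in atTop, ∀ᶠ n : ℕ in atTop, pinchScreen n n m ≤ C * (m : ℝ) ^ (-κ) := by
  rintro ⟨c, hc, j₀, hdrop⟩
  -- the rate `λ = max (1-c) (1/2) ∈ [1/2, 1)` and the exponent `κ = -log₂ λ > 0`, `2^{-κ} = λ`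
  set lam : ℝ := max (1 - c) (1 / 2) with hlam
  have hlam0 : 0 < lam := lt_max_of_lt_right one_half_pos
  have hlam1 : lam < 1 := max_lt (by linarith) one_half_lt_one
  have hclam : 1 - c ≤ lam := le_max_left _ _
  set κ : ℝ := -Real.logb 2 lam with hκ
  have hκ0 : 0 < κ := neg_pos.2 (Real.logb_neg one_lt_two hlam0 hlam1)
  have hlamκ : (2 : ℝ) ^ (-κ) = lam := by
    rw [hκ, neg_neg]
    exact Real.rpow_logb two_pos (by norm_num) hlam0
  refine ⟨κ, (lam ^ (j₀ + 4))⁻¹, hκ0, ?_⟩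
  filter_upwards [eventually_ge_atTop (2 ^ (j₀ + 3))] with m hm
  -- the dyadic scale `K` of `m`: `2^{K+3} ≤ m < 2^{K+4}`, `j₀ ≤ K`
  have hm0 : m ≠ 0 := by have := Nat.one_le_two_pow (n := j₀ + 3); omega
  have hm0' : (0 : ℝ) < m := by exact_mod_cast Nat.pos_of_ne_zero hm0
  obtain ⟨K, hK⟩ : ∃ K : ℕ, K = Nat.log 2 m - 3 := ⟨_, rfl⟩
  have hlog : j₀ + 3 ≤ Nat.log 2 m := Nat.le_log_of_pow_le one_lt_two hm
  have hmK : 2 ^ (K + 3) ≤ m := (show K + 3 = Nat.log 2 m by omega) ▸ Nat.pow_log_le_self 2 hm0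
  have hmK' : m < 2 ^ (K + 4) :=
    (show Nat.log 2 m + 1 = K + 4 by omega) ▸ Nat.lt_pow_succ_log_self one_lt_two m
  have hj₀K : j₀ ≤ K := by omega
  -- the large box sizes: drops on the octaves `j₀ ≤ j < K`, probe points in the box, `m ≤ n`
  have hE : ∀ᶠ n : ℕ in atTop,
      (∀ j ∈ Ico j₀ K, pinchScreen n (2 ^ (j + 1)) m ≤ (1 - c) * pinchScreen n (2 ^ j) m) ∧
        (up m ∈ box 3 n ∧ e₂ ∈ box 3 n ∧ dn m ∈ box 3 n) ∧ m ≤ n := by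
    refine ((Filter.eventually_all_finset _).2 fun j hj => ?_).and
      ((floorsRed_eventually_mem_box m).and (eventually_ge_atTop m))
    rw [mem_Ico] at hj
    refine hdrop j hj.1 m ?_
    calc 2 ^ (j + 3) ≤ 2 ^ (K + 3) := Nat.pow_le_pow_right two_pos (by omega)
      _ ≤ m := hmK
  filter_upwards [hE] with n hn
  obtain ⟨hdropn, ⟨hup, he, hd⟩, hmn⟩ := hn
  -- the geometric squeeze along the octaves `j₀ ≤ j₀ + t ≤ K`
  have hlad : ∀ t : ℕ, t ≤ K - j₀ → pinchScreen n (2 ^ (j₀ + t)) m ≤ lam ^ t := by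
    intro t ht
    induction t with
    | zero =>
      rw [add_zero, pow_zero]
      exact opDecay_pinchScreen_le_one (2 ^ j₀) hup he hd
    | succ t ih =>
      calc pinchScreen n (2 ^ (j₀ + (t + 1))) m = pinchScreen n (2 ^ (j₀ + t + 1)) m := by
            rw [add_assoc]
        _ ≤ (1 - c) * pinchScreen n (2 ^ (j₀ + t)) m :=
            hdropn (j₀ + t) (mem_Ico.2 ⟨Nat.le_add_right j₀ t, by omega⟩)
        _ ≤ lam * pinchScreen n (2 ^ (j₀ + t)) m :=
            mul_le_mul_of_nonneg_right hclam (opDecay_pinchScreen_nonneg (2 ^ (j₀ + t)) he hd)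
        _ ≤ lam * lam ^ t := mul_le_mul_of_nonneg_left (ih (by omega)) hlam0.le
        _ = lam ^ (t + 1) := by rw [pow_succ, mul_comm]
  have hAK : pinchScreen n (2 ^ K) m ≤ lam ^ (K - j₀) := by
    have h := hlad (K - j₀) le_rfl
    rwa [show j₀ + (K - j₀) = K by omega] at h
  -- antitonicity down to the full radius, and `λ^{K-j₀} ≤ λ^{-(j₀+4)} m^{-κ}`
  have h2K : 2 ^ K ≤ n :=
    calc 2 ^ K ≤ 2 ^ (K + 3) := Nat.pow_le_pow_right two_pos (Nat.le_add_right K 3)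
      _ ≤ m := hmK
      _ ≤ n := hmn
  calc pinchScreen n n m ≤ pinchScreen n (2 ^ K) m := floorsNec_pinchScreen_anti h2K hup he hd
    _ ≤ lam ^ (K - j₀) := hAK
    _ ≤ (lam ^ (j₀ + 4))⁻¹ * (m : ℝ) ^ (-κ) := by
        rw [le_inv_mul_iff₀ (pow_pos hlam0 _)]
        calc lam ^ (j₀ + 4) * lam ^ (K - j₀) = lam ^ (K + 4) := by
              rw [← pow_add]; congr 1; omega
          _ = ((2 : ℝ) ^ (K + 4)) ^ (-κ) := by
              rw [EnergyNotSigmaSquaredGapForcesFarMergingSandwich.OctaveCountingProof.two_pow_rpow_neg,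
                hlamκ]
          _ ≤ (m : ℝ) ^ (-κ) :=
              Real.rpow_le_rpow_of_nonpos hm0' (by exact_mod_cast hmK'.le) (by linarith)

end Summit.CriticalPhenomena.Ising3DConformalLimit.EnergyNotSigmaSquaredGapForcesFarMerging

end
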